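import Mathlib
import Summits.BirchSwinnertonDyer.BirchSwinnertonDyer.Theorems.SignedLowerHalvesKobayashiLowerHalfSemistableDefiniteLineUnitLift
import HarnessLib

/-!
# Typing guardrail for the crux idea `definite-line-unit-lift` (crux `KobayashiLowerHalfSemistable`,
# item stmt-BirchSwinnertonDyer-19000, route `SignedLowerHalves`): a two-variable pair pinned ONLY by
# its two line restrictions is a COSTUME; pinned by (P1) + an Euler system + the definite line, it is NOT

Ideator seat `bsd-idea-13` (gen 3), evidence file; sorry-free ring theory; asserts nothing about any
curve; BSD is not proved here.

THE QUESTION (gen 3). The landed Transfer theorem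
`…Theorems.DefiniteLineUnitLift.dvd_of_definiteLine_transfer` (p610118) reads, in the model
`Λ_K = ℤ_p⟦T_inner⟧⟦T_outer⟧ = PowerSeries (IwasawaAlgebra p)` (definite line `T_outer = 0` =
`PowerSeries.constantCoeff`, cyclotomic line `T_inner = 0` = `PowerSeries.map PowerSeries.constantCoeff`):
two-variable Kato direction `ξ ∣ L`, torsion + EQUALITY on the definite line, factorizations
`ξ(0,T) = a·b`, `L(0,T) = x·y` on the cyclotomic line, `b ≠ 0`, `b ∣ y` ⟹ `x ∣ a`. Can the card become a
registered line on the crux by taking as ONE stub the existence of such a pair `(ξ, L)` — the two-variable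
signed Selmer characteristic series and the two-variable signed `p`-adic `L`-function being, today, NOT
constructed in the tree (the W-6 definition items `defn-SignedSelmerTwoVariable` /
`defn-SignedLFunctionTwoVariable` were closed by recasting them as fields of the conjoined existential
PRE binder `BurungaleSkinnerTianWan2024.props118_27_519_exists_signedTwoVariablePackage_supersingular_PRE`)?

THE ANSWER (this file): NO. `exists_linePinned_iff`: over any domain `R`, the statement «there exist
`ξ L ∈ R⟦Y⟧⟦X⟧` with `ξ ∣ L`, `ξ|_{X=0} ≠ 0`, `ξ|_{X=0} ~ L|_{X=0}`, `ξ|_{Y=0} = P`, `L|_{Y=0} = Q`» is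
EQUIVALENT to «`P ~ Q` in `R⟦X⟧`». Direction ⇒ is the unit lift (p610118); direction ⇐ is the explicit
BAD LIFT `badLift P = (P₀ + Y) + Σ_{n≥1} Pₙ Xⁿ`, `L = badLift P · u`. In the card's currency
(`exists_transferData_iff`): the existential stub would say exactly `a·b ~ x·y` in `Λ` — the cyclotomic
main-conjecture EQUALITY for `E × E^K` up to a unit, STRONGER than the crux (which wants one divisibility
for `E`) and free of any two-variable content: a costume, not a line. Consequently a faithful typing of the
card's line needs two-variable carriers that are CANONICAL (constructed), or at least pinned by data that
is not a line restriction. `anchored_rescale` records why the one extra pin available in the tree today —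
the BSTW identity (P1) `ξ_∘ · G = Char(X_Gr₂)^ur · 𝓛^∘` with the canonical Greenberg pair — pins only the
RATIO `ξ_∘/𝓛^∘`: the solution set of (P1) is stable under `(ξ, L) ↦ (ξ·t, L·t)`, so every statement about
the pair that (P1) makes meaningful is a statement about `Char(X_Gr₂)/G`, i.e. lives in Greenberg
currency — where the card's anchor line (a DEFINITE `K`) is the exceptional-zero line of `G`.

THE POSITIVE COUNTERPART (section `SignedAnchor`): what a faithful line CAN consume from EXISTENTIAL
signed carriers. `associated_of_signedLineAnchor`: in `A⟦T₁⟧` over a domain `A` (= `𝒪⟦T₂⟧`), from (P1) in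
IDEAL form with a principal CANONICAL ideal `I` (= `Ch(X_Gr₂)^ur`), the two-variable Euler-system
inclusion `(G) ⊆ I` (stmt-20728's shape), `G ≠ 0`, and two statements ON THE DEFINITE LINE about the
existential pair — non-degeneracy `L(0,·) ≠ 0` (true for a definite `K`, false for a Heegner `K`) and the
Eisenstein divisibility `L(0,·) ∣ ξ(0,·)` — one gets the two-variable association `ξ ~ L`, hence
(`associated_map_of_signedLineAnchor`) association on the cyclotomic line, the input of p610118; and
`generator_constantCoeff_eq_zero`: (P1) with `G(0,·) = 0`, `L(0,·) ≠ 0` forces `c(0,·) = 0` — the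
Greenberg characteristic ideal vanishes on the definite line and the lift never divides by it. Both line
statements are invariant under the residual ambiguity of the pair (`lineAnchor_rescale_iff`), so a line
stating them in `∀`-form over all package solutions is faithful WITHOUT a constructed `X_∘`: this is
`SignedBaseChangeK1Acanchor.le_span_of_anchor` with the roles of the Greenberg and the signed pair
exchanged, and it is the typed shape of the card's would-be line (card REVISION g3, G4).

References: card `Cruxes/KobayashiLowerHalfSemistable/Ideas/definite-line-unit-lift.md`; p610118;
`Literature/…/BurungaleSkinnerTianWan2024/SignedTwoVariableDescentPackagePRE.lean` (module docstring
"Why this shape": the typer's prose version of the same warning for `∀`-facts over unpinned carriers).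
-/

set_option autoImplicit false
set_option linter.dupNamespace false

noncomputable section

namespace Summit.BirchSwinnertonDyer.BirchSwinnertonDyer.Cruxes.KobayashiLowerHalfSemistable.DefiniteLineUnitLiftGuardrail

open Summit.BirchSwinnertonDyer.BirchSwinnertonDyer.Theorems

section BadLift

variable {R : Type*} [CommRing R]

/-- The BAD LIFT of `P = Σ Pₙ Xⁿ ∈ R⟦X⟧` to `R⟦Y⟧⟦X⟧` (outer variable `X`, inner variable `Y`):
`badLift P = (P₀ + Y) + Σ_{n ≥ 1} Pₙ Xⁿ`. -/
def badLift (P : PowerSeries R) : PowerSeries (PowerSeries R) :=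
  PowerSeries.map (PowerSeries.C (R := R)) P + PowerSeries.C (PowerSeries.X : PowerSeries R)

/-- Killing the inner variable undoes the coefficientwise constant lift. -/
theorem map_constantCoeff_map_C (S : PowerSeries R) :
    PowerSeries.map PowerSeries.constantCoeff (PowerSeries.map (PowerSeries.C (R := R)) S) = S := by
  ext n
  simp [PowerSeries.coeff_map]

/-- The `Y = 0` restriction of the bad lift is `P`. -/
theorem map_constantCoeff_badLift (P : PowerSeries R) :
    PowerSeries.map PowerSeries.constantCoeff (badLift P) = P := by
  ext n
  simp [badLift, PowerSeries.coeff_map]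

/-- The `X = 0` restriction of the bad lift is `P₀ + Y`. -/
theorem constantCoeff_badLift (P : PowerSeries R) :
    PowerSeries.constantCoeff (badLift P) =
      PowerSeries.C (PowerSeries.constantCoeff P) + PowerSeries.X := by
  have h : PowerSeries.coeff 0 (badLift P) =
      PowerSeries.C (PowerSeries.coeff 0 P) + PowerSeries.X := by
    simp only [badLift, map_add, PowerSeries.coeff_map, PowerSeries.coeff_zero_C]
  simpa only [PowerSeries.coeff_zero_eq_constantCoeff_apply] using h

/-- … which is never zero (its `Y¹`-coefficient is `1`). -/
theorem constantCoeff_badLift_ne_zero [Nontrivial R] (P : PowerSeries R) :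
    PowerSeries.constantCoeff (badLift P) ≠ 0 := by
  rw [constantCoeff_badLift]
  intro h
  have h1 := congrArg (PowerSeries.coeff 1) h
  simp [PowerSeries.coeff_one_X] at h1

end BadLift

section Collapse

variable {R : Type*} [CommRing R] [IsDomain R]

/-- **Costume collapse.** In `R⟦Y⟧⟦X⟧` over a domain: a pair `(ξ, L)` constrained only by the
two-variable divisibility `ξ ∣ L`, torsion and EQUALITY (association) on the line `X = 0`, and prescribed
restrictions `P`, `Q` to the line `Y = 0` EXISTS if and only if `P ~ Q`. (⇒ is the unit lift of p610118,
`DefiniteLineUnitLift.associated_mapConstantCoeff_of_dvd_of_associated_constantCoeff`; ⇐ is the bad lift.) -/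
theorem exists_linePinned_iff (P Q : PowerSeries R) :
    (∃ ξ L : PowerSeries (PowerSeries R), ξ ∣ L ∧ PowerSeries.constantCoeff ξ ≠ 0 ∧
        Associated (PowerSeries.constantCoeff ξ) (PowerSeries.constantCoeff L) ∧
        PowerSeries.map PowerSeries.constantCoeff ξ = P ∧
        PowerSeries.map PowerSeries.constantCoeff L = Q) ↔
      Associated P Q := by
  constructor
  · rintro ⟨ξ, L, hdvd, hne, hass, rfl, rfl⟩
    exact DefiniteLineUnitLift.associated_mapConstantCoeff_of_dvd_of_associated_constantCoeff hdvd hne hass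
  · rintro ⟨u, rfl⟩
    refine ⟨badLift P, badLift P * PowerSeries.map (PowerSeries.C (R := R)) (u : PowerSeries R),
      dvd_mul_right _ _, constantCoeff_badLift_ne_zero P, ?_, map_constantCoeff_badLift P, ?_⟩
    · have hu : IsUnit (PowerSeries.constantCoeff
          (PowerSeries.map (PowerSeries.C (R := R)) (u : PowerSeries R))) :=
        (u.isUnit.map _).map _
      rw [map_mul]
      exact associated_mul_unit_right _ _ hu
    · rw [map_mul, map_constantCoeff_badLift, map_constantCoeff_map_C]

end Collapse

section CardCurrency

open Literature.NumberTheory.EllipticCurves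

variable {p : ℕ} [Fact p.Prime]

/-- **The guardrail in the card's currency** (`Λ_K = PowerSeries (IwasawaAlgebra p)`, the hypothesis
list of p610118's `dvd_of_definiteLine_transfer` minus the two cyclotomic-line inputs `b ≠ 0`, `b ∣ y`):
bundling the five two-variable hypotheses into ONE existential stub yields exactly «`a·b ~ x·y` in `Λ`» —
the cyclotomic main-conjecture EQUALITY for the pair `(E, E^K)` up to `Λˣ`, with no two-variable content.
Such a stub is STRONGER than the crux and is a costume; it must not be registered. -/
theorem exists_transferData_iff (a b x y : IwasawaAlgebra p) :
    (∃ ξ L : PowerSeries (IwasawaAlgebra p), ξ ∣ L ∧ PowerSeries.constantCoeff ξ ≠ 0 ∧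
        Associated (PowerSeries.constantCoeff ξ) (PowerSeries.constantCoeff L) ∧
        PowerSeries.map PowerSeries.constantCoeff ξ = a * b ∧
        PowerSeries.map PowerSeries.constantCoeff L = x * y) ↔
      Associated (a * b) (x * y) :=
  exists_linePinned_iff (R := ℤ_[p]) (a * b) (x * y)

/-- What the collapsed statement buys and costs on the cyclotomic line: together with the Kato
directions `a ∣ x`, `b ∣ y` and `a·b ≠ 0` it is EQUIVALENT to both equalities `a ~ x`, `b ~ y`
(so the would-be stub is the main conjecture for `E` AND for `E^K`, not one divisibility for `E`). -/
theorem associated_and_associated_iff {α : Type*} [CommMonoidWithZero α] [IsCancelMulZero α]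
    {a b x y : α} (hab : a * b ≠ 0) (hax : a ∣ x) (hby : b ∣ y) :
    Associated (a * b) (x * y) ↔ Associated a x ∧ Associated b y := by
  constructor
  · intro h
    have ha : a ≠ 0 := left_ne_zero_of_mul hab
    have hb : b ≠ 0 := right_ne_zero_of_mul hab
    obtain ⟨s, rfl⟩ := hax
    obtain ⟨t, rfl⟩ := hby
    obtain ⟨u, hu⟩ := h.symm
    -- `a s b t u = a b` ⇒ `s t u = 1` ⇒ `s`, `t` units
    have hst : s * t * (u : α) = 1 := by
      have h1 : a * b * (s * t * (u : α)) = a * b * 1 := by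
        rw [mul_one]
        calc a * b * (s * t * (u : α)) = a * s * (b * t) * (u : α) := by ac_rfl
          _ = a * b := hu
      exact mul_left_cancel₀ hab h1
    have hs : IsUnit s := IsUnit.of_mul_eq_one (t * (u : α)) (by
      calc s * (t * (u : α)) = s * t * (u : α) := (mul_assoc _ _ _).symm
        _ = 1 := hst)
    have ht : IsUnit t := IsUnit.of_mul_eq_one (s * (u : α)) (by
      calc t * (s * (u : α)) = s * t * (u : α) := by ac_rfl
        _ = 1 := hst)
    exact ⟨associated_mul_unit_right a s hs, associated_mul_unit_right b t ht⟩
  · rintro ⟨h₁, h₂⟩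
    exact h₁.mul_mul h₂

end CardCurrency

section Anchor

/-- **Why the BSTW identity (P1) does not rescue the existential.** Any identity of the shape
`ξ · G = v · c · L` (the package's (P1): `c` a generator of `Char(X_Gr₂)^ur`, `G` the Greenberg function,
`v` a unit) is stable under the common rescaling `(ξ, L) ↦ (ξ·t, L·t)`: (P1) pins the RATIO `ξ/L = v·c/G`
and nothing else, so any further conjunct on the pair that is not rescaling-invariant is again satisfiable
by a bad choice of `t`, and every rescaling-invariant conjunct is a statement about the canonical Greenberg
pair `(c, G)`. [folklore] -/
theorem anchored_rescale {S : Type*} [CommRing S] {ξ L G c v : S} (h : ξ * G = v * c * L) (t : S) :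
    (ξ * t) * G = v * c * (L * t) := by
  calc (ξ * t) * G = (ξ * G) * t := by ring
    _ = v * c * L * t := by rw [h]
    _ = v * c * (L * t) := by ring

/-- … in particular a LINE ANCHOR «`π ξ ∣ π L · w`» (divisibility of the two restrictions along a ring map
`π`, e.g. `T₁ ↦ 0`) is rescaling-invariant whenever `π t` is a non-zero-divisor: it holds for `(ξ·t, L·t)`
iff it holds for `(ξ, L)`. So a line anchor added to (P1) constrains only `c/G` on that line — for the
card's DEFINITE `K` the line `T₁ = 0` is the exceptional-zero line of `G`, where this is empty. [folklore] -/
theorem lineAnchor_rescale_iff {S T : Type*} [CommRing S] [CommRing T] (π : S →+* T) {ξ L t : S}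
    (ht : π t ∈ nonZeroDivisors T) :
    π (ξ * t) ∣ π (L * t) ↔ π ξ ∣ π L := by
  rw [map_mul, map_mul]
  constructor
  · rintro ⟨w, hw⟩
    refine ⟨w, ?_⟩
    apply mul_cancel_right_mem_nonZeroDivisors ht |>.mp
    calc π L * π t = π ξ * π t * w := hw
      _ = π ξ * w * π t := by ring
  · rintro ⟨w, hw⟩
    exact ⟨w, by rw [hw]; ring⟩

end Anchor

section SignedAnchor

/-! ### The positive counterpart: the anchor in SIGNED currency composes with EXISTENTIAL carriers

What a faithful line CAN consume from the package binder without any constructed signed carrier: the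
(P1) identity in IDEAL form with the CANONICAL Greenberg ideal `I = Ch(X_Gr₂)^ur` (principal), the
two-variable Euler-system inclusion `(G) ⊆ I` (stmt-20728's shape), and two LINE statements about the
existential pair on the definite line `T₁ = 0` (`PowerSeries.constantCoeff`): non-degeneracy
`L(0,·) ≠ 0` (true for a DEFINITE `K`, false for a Heegner `K`) and the Eisenstein divisibility
`L(0,·) ∣ ξ(0,·)`. Conclusion: the full two-variable association `ξ ~ L` — although `G(0,·) = 0` and
`c(0,·) = 0` on that line. Both line statements are invariant under the residual ambiguity of the
existential pair (common rescaling, `lineAnchor_rescale_iff`), so stating them in `∀`-form over all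
package solutions is faithful. This is `SignedBaseChangeK1Acanchor.le_span_of_anchor` with the roles of
the Greenberg and the signed pair exchanged. [folklore] -/

variable {A : Type*} [CommRing A] [IsDomain A]

/-- **Signed-currency anchor lift.** In `A⟦T₁⟧` over a domain `A` (think `A = 𝒪⟦T₂⟧`, line `T₁ = 0` =
`constantCoeff`): if `I` is principal, `(ξ·G) = I·(L)` (P1), `(G) ⊆ I` (two-variable Euler system),
`G ≠ 0`, `L(0) ≠ 0` and `L(0) ∣ ξ(0)` (Eisenstein divisibility ON THE LINE for the signed pair), then
`ξ ~ L`. Proof: `I = (c)`, `G = c·h`, `ξ·c·h ~ c·L` gives `L = ξ·h·u`; on the line `L₀ = ξ₀h₀u₀` and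
`ξ₀ = L₀m` force `m·h₀·u₀ = 1`, so `h` is a unit (`PowerSeries.isUnit_iff_constantCoeff`). -/
theorem associated_of_signedLineAnchor {I : Ideal (PowerSeries A)} (hI : I.IsPrincipal)
    {ξ L G : PowerSeries A}
    (hP1 : Ideal.span {ξ * G} = I * Ideal.span {L})
    (hES : Ideal.span {G} ≤ I) (hG : G ≠ 0)
    (hne : PowerSeries.constantCoeff L ≠ 0)
    (hanch : PowerSeries.constantCoeff L ∣ PowerSeries.constantCoeff ξ) :
    Associated ξ L := by
  obtain ⟨⟨c, hc⟩⟩ := hI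
  have hc' : I = Ideal.span {c} := hc
  subst hc'
  -- `G = c * h`
  obtain ⟨h, rfl⟩ : c ∣ G :=
    Ideal.mem_span_singleton.mp (hES (Ideal.mem_span_singleton_self G))
  have hc0 : c ≠ 0 := left_ne_zero_of_mul hG
  -- (P1) as an association `ξ * (c * h) ~ c * L`
  have hP1' : Ideal.span {ξ * (c * h)} = Ideal.span {c * L} := by
    rw [hP1, Ideal.span_singleton_mul_span_singleton]
  obtain ⟨u, hu⟩ := (Ideal.span_singleton_eq_span_singleton.mp hP1')
  -- cancel `c`: `L = ξ * h * u`
  have hL : L = ξ * (h * u) := by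
    apply mul_left_cancel₀ hc0
    calc c * L = ξ * (c * h) * u := hu.symm
      _ = c * (ξ * (h * u)) := by ring
  -- on the line: `h(0)` is a unit
  have h0 : PowerSeries.constantCoeff L =
      PowerSeries.constantCoeff ξ * (PowerSeries.constantCoeff h * PowerSeries.constantCoeff (u : PowerSeries A)) := by
    conv_lhs => rw [hL]
    simp [map_mul]
  obtain ⟨m, hm⟩ := hanch
  have h1 : PowerSeries.constantCoeff h *
      (PowerSeries.constantCoeff (u : PowerSeries A) * m) = 1 := by
    apply mul_left_cancel₀ hne
    calc PowerSeries.constantCoeff L *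
          (PowerSeries.constantCoeff h * (PowerSeries.constantCoeff (u : PowerSeries A) * m))
          = (PowerSeries.constantCoeff L * m) *
            (PowerSeries.constantCoeff h * PowerSeries.constantCoeff (u : PowerSeries A)) := by ring
      _ = PowerSeries.constantCoeff ξ *
            (PowerSeries.constantCoeff h * PowerSeries.constantCoeff (u : PowerSeries A)) := by rw [← hm]
      _ = PowerSeries.constantCoeff L := h0.symm
      _ = PowerSeries.constantCoeff L * 1 := (mul_one _).symm
  have hhu : IsUnit h :=
    PowerSeries.isUnit_iff_constantCoeff.mpr (IsUnit.of_mul_eq_one _ h1)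
  refine ⟨hhu.unit * u, ?_⟩
  rw [hL, Units.val_mul, IsUnit.unit_spec]

/-- … and then the pair is associated on EVERY line, in particular on the cyclotomic one
(`PowerSeries.map PowerSeries.constantCoeff` in the model of p610118, `UnrSeries₂.plus` in the tree's
receptacle): the input that p610118's `dvd_of_definiteLine_transfer` consumes. -/
theorem associated_map_of_signedLineAnchor {B : Type*} [CommRing B] (φ : PowerSeries A →+* B)
    {I : Ideal (PowerSeries A)} (hI : I.IsPrincipal) {ξ L G : PowerSeries A}
    (hP1 : Ideal.span {ξ * G} = I * Ideal.span {L})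
    (hES : Ideal.span {G} ≤ I) (hG : G ≠ 0)
    (hne : PowerSeries.constantCoeff L ≠ 0)
    (hanch : PowerSeries.constantCoeff L ∣ PowerSeries.constantCoeff ξ) :
    Associated (φ ξ) (φ L) :=
  (associated_of_signedLineAnchor hI hP1 hES hG hne hanch).map φ

/-- **Consistency with the exceptional-zero line.** (P1) alone already forces: if the Greenberg
function vanishes on the line (`G(0) = 0`, the DEFINITE case) and the signed `L` does not (`L(0) ≠ 0`),
then every generator `c` of `I` vanishes there too (`c(0) = 0`): the Greenberg characteristic ideal
vanishes on the definite line — and the anchor lift above never divides by `G(0)` or `c(0)`. -/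
theorem generator_constantCoeff_eq_zero {I : Ideal (PowerSeries A)} {c ξ L G : PowerSeries A}
    (hc : I = Ideal.span {c})
    (hP1 : Ideal.span {ξ * G} = I * Ideal.span {L})
    (hne : PowerSeries.constantCoeff L ≠ 0)
    (hG0 : PowerSeries.constantCoeff G = 0) :
    PowerSeries.constantCoeff c = 0 := by
  have hP1' : Ideal.span {ξ * G} = Ideal.span {c * L} := by
    rw [hP1, hc, Ideal.span_singleton_mul_span_singleton]
  obtain ⟨u, hu⟩ := (Ideal.span_singleton_eq_span_singleton.mp hP1')
  have key := congrArg PowerSeries.constantCoeff hu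
  simp only [map_mul, hG0, mul_zero, zero_mul] at key
  -- key : 0 = constantCoeff c * constantCoeff L
  exact (mul_eq_zero.mp key.symm).resolve_right hne

end SignedAnchor

end Summit.BirchSwinnertonDyer.BirchSwinnertonDyer.Cruxes.KobayashiLowerHalfSemistable.DefiniteLineUnitLiftGuardrail

end
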